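import Literature.Analysis.OperatorTheory.Enflo2023.MCStep
import Literature.Analysis.OperatorTheory.Enflo2023.PartAHandoff
import Literature.Analysis.OperatorTheory.Enflo2023.TypeDichotomy
import Literature.Analysis.OperatorTheory.Enflo2023.PipelineL2
import Literature.Analysis.OperatorTheory.Enflo2023.Reductions
import HarnessLib

/-!
# Enflo 2023, end to end in the kernel reading: `ISP_separable` from ONE named residual, and the glue G1

Source under adjudication: Per H. Enflo, *On the invariant subspace problem in Hilbert spaces*, arXiv:2305.15442
(v2, 2024), bib key `Enflo2023` — a CLAIMED proof (claimed result under adjudication).  b2b-enflo repair cell,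
formaliser 2, BLOCK-2b capstone.  NOTHING here proves the manuscript's theorem: `Referee.ISP_separable` appears only
as the CONCLUSION of an implication whose hypothesis `PartBResidual` — the cell's typed residual of Part B, the
step clause of the Main Construction (v2 p.17 l.578–583, (40), (45), (46)) packaged over all normalised operators —
is NOT proved anywhere in the tree (and is shown in `ClaimAudit` to be satisfiable by `T = 0` and unsatisfiable with
drift constant `C < 1`).  What the file records, with kernel certainty:

* `MCStep.State.ofMinimal` / `nis_of_claim` — in the kernel typing the Main-Construction endgame
  (`MCStep.hasNontrivialClosedInvariantSubspace_of_claim`) needs NO Part-A input: the residual `MCStep.Claim` is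
  quantified over ALL pivot states, and a start state always exists (the minimal move of `y = x₀` at radius `0.7`).
  This makes visible a typing divergence to be weighed by the referee: the manuscript needs its step only along THE
  run started from Part A's exit vector (`(εθ) ≤ 1.12·10⁻⁴`, (33)), the typed residual asks it everywhere.
* `exists_state_of_partA` — glue G1 (referee gen-18/19: "ExitStage hands out exit data, MCStep consumes a `State`;
  the conversion is in neither file"): Part A's hand-off (`CaseII.partA_handoff`) IS an `MCStep.State T x₀ Vy.S`
  (`V = V_y`, `ε = ‖x₀ − y‖`, `a = c` THE minimiser) carrying `(εθ)_y ∈ (0, 1.12(εθ)₀]` and (33) — PROVIDED the start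
  window is read as `0.3 + 2.2(εθ)₀ ≤ ‖x₀ − y₁'‖ ≤ 0.7` (the exit radius is only `≥ ‖x₀ − y₁'‖ − 2.2(εθ)₀`, while
  `MCStep.State.hε` is the hard `0.3 ≤ ε`; census R-V14, `2.2(εθ)₀ ≤ 2.2·10⁻⁴`).  `nis_of_partA_and_claim` is the
  literal composition Part A ⟶ Part B endgame under the residual.
* `PartBResidual` and `isp_of_partBResidual : PartBResidual → Referee.ISP_separable` — the whole pipeline: scaling
  to `‖T‖ = 10⁻²⁰` (`wlog_opNorm`), `T = 0` aside (an eigenline), the endgame.  So the cell's record reads: the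
  manuscript's theorem follows IN THE KERNEL from exactly one unproved statement, `PartBResidual`.

[cite: Enflo2023, v2 p.5 (normalisations), p.13 (26), p.15 (33), p.17 l.578–583, pp.18–20 (40)–(46), p.22 (11)]
No new axioms; closure `[propext, Classical.choice, Quot.sound]`.
-/

noncomputable section

open scoped InnerProductSpace
open Filter Topology

namespace Literature.Analysis.OperatorTheory.Enflo2023

namespace MCStep

variable {H : Type*} [NormedAddCommGroup H] [InnerProductSpace ℂ H] [CompleteSpace H]

/-- A true MC state from its data: the orbit operator `V_y` of `y` (for `‖T‖ < 1`), a radius in the window and a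
minimal solution of (1). [cite: Enflo2023, v2 p.2 (1), p.17 l.578] -/
def State.ofMinimal (T : H →L[ℂ] H) (hT : ‖T‖ < 1) (x₀ y : H) {ε : ℝ} (hε : (0.3 : ℝ) ≤ ε ∧ ε ≤ 0.7)
    {a : Vy.ℓ2} (ha : IsMinimal (Vy.V T hT y) x₀ ε a) : State T x₀ Vy.S :=
  ⟨Vy.V T hT y, Vy.V_shift T hT y, ε, hε, a, ha⟩

/-- The fields of `State.ofMinimal`. [cite: Enflo2023, v2 p.17 l.578] -/
theorem State.ofMinimal_spec (T : H →L[ℂ] H) (hT : ‖T‖ < 1) (x₀ y : H) {ε : ℝ} (hε : (0.3 : ℝ) ≤ ε ∧ ε ≤ 0.7)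
    {a : Vy.ℓ2} (ha : IsMinimal (Vy.V T hT y) x₀ ε a) :
    (State.ofMinimal T hT x₀ y hε ha).V = Vy.V T hT y ∧ (State.ofMinimal T hT x₀ y hε ha).ε = ε ∧
      (State.ofMinimal T hT x₀ y hε ha).a = a :=
  ⟨rfl, rfl, rfl⟩

/-- A start state always exists: the minimal move of `y = x₀` itself at radius `0.7`. [cite: Enflo2023, v2 p.2 (1),
p.5 (window)] -/
theorem exists_state_start (T : H →L[ℂ] H) (hT : ‖T‖ < 1) (x₀ : H) : Nonempty (State T x₀ Vy.S) := by
  obtain ⟨a, ha⟩ := Vy.exists_isMinimal_of_norm_sub_le T hT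
    (show ‖x₀ - x₀‖ ≤ (0.7 : ℝ) by rw [sub_self, norm_zero]; norm_num)
  exact ⟨State.ofMinimal T hT x₀ x₀ ⟨by norm_num, le_rfl⟩ ha⟩

/-- **The endgame needs no Part-A input in the kernel typing.**  For `‖T‖ < 1` and a unit vector `x₀`, the residual
`MCStep.Claim T x₀ Vy.S C β G` (with the endgame's side conditions on `C, β, G`) alone gives a non-trivial closed
invariant subspace — the start state is the minimal move of `x₀` at radius `0.7`. [cite: Enflo2023, v2 p.17
l.578–583, p.22 (11)] -/
theorem nis_of_claim (T : H →L[ℂ] H) (hT : ‖T‖ < 1) (x₀ : H) (hx₀ : ‖x₀‖ = 1) {C β : ℝ} (hC : 0 ≤ C)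
    (hβ : 0 < β) (hβ1 : β ≤ 1) (G : ℝ → ℝ) (hG0 : ∀ x, 0 ≤ G x)
    (hG : ∀ η : ℝ, 0 < η → ∃ δ : ℝ, 0 < δ ∧ ∀ x, 0 ≤ x → x ≤ δ → G x ≤ η) (hclaim : Claim T x₀ Vy.S C β G) :
    HasNontrivialClosedInvariantSubspace T := by
  obtain ⟨s₀⟩ := exists_state_start T hT x₀
  exact hasNontrivialClosedInvariantSubspace_of_claim T x₀ hx₀ Vy.S Vy.norm_S_le hC hβ hβ1 G hG0 hG hclaim s₀

end MCStep

namespace EndToEnd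

variable {H : Type*} [NormedAddCommGroup H] [InnerProductSpace ℂ H] [CompleteSpace H]

open Vy Lemma2 MCStep

/-- **Glue G1: Part A's hand-off is an MC state.**  Standing data at `y₀ = y₁'` as in `CaseII.partA_handoff`, with the
start window read as `0.3 + 2.2(εθ)₀ ≤ ‖x₀ − y₀‖ ≤ 0.7` (so that the exit radius `≥ ‖x₀ − y₀‖ − ‖y − y₀‖` stays in the
hard window `[0.3, 0.7]` of `MCStep.State`): EITHER `T` has a non-trivial closed invariant subspace, OR there are the
exit vector `y` of THE (26)-run and a state `s : MCStep.State T x₀ Vy.S` with `s.V = V_y`, `s.ε = ‖x₀ − y‖`, whose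
`s.a` is THE minimiser, with `(εθ)_y ∈ (0, 1.12(εθ)₀]`, `‖y − y₀‖ ≤ 2.2(εθ)₀`, `y ∈ Adm u₀`, (9) at `y`, and (33) for
`s.a`. [cite: Enflo2023, v2 p.13 (26) tex L443–L450, p.15 (33), p.17 l.578] -/
theorem exists_state_of_partA (T : H →L[ℂ] H) (hT : ‖T‖ < 1) (hT20 : ‖T‖ ≤ 1 / 10 ^ 20) (x₀ y₀ u₀ : H)
    (hx₀ : ‖x₀‖ = 1)
    (hwin : 0.3 + 2.2 * (⟪x₀ - y₀, y₀⟫_ℂ).re ≤ ‖x₀ - y₀‖ ∧ ‖x₀ - y₀‖ ≤ 0.7) (him : (⟪x₀ - y₀, y₀⟫_ℂ).im = 0)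
    (ht0 : 0 ≤ (⟪x₀ - y₀, y₀⟫_ℂ).re) (ht1 : (⟪x₀ - y₀, y₀⟫_ℂ).re ≤ 1 / 10 ^ 4)
    (h9 : ∀ m : ℕ, ‖⟪x₀ - y₀, (T ^ m) y₀⟫_ℂ‖ ≤ (⟪x₀ - y₀, y₀⟫_ℂ).re)
    (hu₀ : ‖u₀‖ ≤ 1) (hA : ‖y₀‖ / 100 ≤ (⟪u₀, y₀⟫_ℂ).re) :
    HasNontrivialClosedInvariantSubspace T ∨
      ∃ (y : H) (s : State T x₀ Vy.S),
        s.V = V T hT y ∧ s.ε = ‖x₀ - y‖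
        ∧ 0 < (⟪x₀ - y, y⟫_ℂ).re
        ∧ (⟪x₀ - y, y⟫_ℂ).im = 0
        ∧ (⟪x₀ - y, y⟫_ℂ).re ≤ 1.12 * (⟪x₀ - y₀, y₀⟫_ℂ).re
        ∧ ‖y - y₀‖ ≤ 2.2 * (⟪x₀ - y₀, y₀⟫_ℂ).re
        ∧ y ∈ Adm u₀
        ∧ (∀ m : ℕ, ‖⟪x₀ - y, (T ^ m) y⟫_ℂ‖ ≤ (⟪x₀ - y, y⟫_ℂ).re)
        ∧ (∃ j, 1 ≤ j ∧ (⟪x₀ - y, y⟫_ℂ).re ^ 4 < ‖⟪x₀ - y, (T ^ j) y⟫_ℂ‖)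
        ∧ 1 - gammaEps T hT u₀ (⟪x₀ - y, y⟫_ℂ).re ≤ ‖s.a 0‖ ^ 2
        ∧ ‖s.a 0‖ ^ 2 ≤ 1 - (98 / 100 * 10 ^ 20 * (⟪x₀ - y, y⟫_ℂ).re ^ 11) ^ 2
        ∧ (98 / 100 * 10 ^ 20 * (⟪x₀ - y, y⟫_ℂ).re ^ 11) ^ 2 ≤ ‖L s.a‖ ^ 2
        ∧ ‖L s.a‖ ^ 2 ≤ gammaEps T hT u₀ (⟪x₀ - y, y⟫_ℂ).re
        ∧ (1 - gammaEps T hT u₀ (⟪x₀ - y, y⟫_ℂ).re) * ‖s.a‖ ^ 2 ≤ ‖s.a 0‖ ^ 2 := by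
  have hwin' : 0.3 ≤ ‖x₀ - y₀‖ ∧ ‖x₀ - y₀‖ ≤ 0.7 := ⟨by linarith [hwin.1], hwin.2⟩
  rcases CaseII.partA_handoff T hT hT20 x₀ y₀ u₀ hx₀ hwin' him ht0 ht1 h9 hu₀ hA with hinv |
      ⟨y, c, htN, himN, hupN, -, hdN, hdisp, hAdm, h9N, hI, hc, h33a, h33b, h33c, h33d, h33e⟩
  · exact Or.inl hinv
  · have h03 : (0.3 : ℝ) ≤ ‖x₀ - y‖ := by
      have := norm_sub_le_norm_sub_add_norm_sub x₀ y y₀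
      linarith [hwin.1]
    exact Or.inr ⟨y, State.ofMinimal T hT x₀ y ⟨h03, hdN⟩ hc, rfl, rfl, htN, himN, hupN, hdisp, hAdm, h9N, hI,
      h33a, h33b, h33c, h33d, h33e⟩

/-- **Part A ⟶ Part B, literally.**  Standing data at `y₁'` (window as in `exists_state_of_partA`) together with the
Part-B residual `MCStep.Claim T x₀ Vy.S C β G` (and the endgame's side conditions) give a non-trivial closed invariant
subspace, the Main Construction being started at Part A's exit state.  (By `MCStep.nis_of_claim` the Part-A hypotheses
are in fact redundant in the kernel typing.) [cite: Enflo2023, v2 p.13 (26), p.17 l.578–583, p.22 (11)] -/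
theorem nis_of_partA_and_claim (T : H →L[ℂ] H) (hT : ‖T‖ < 1) (hT20 : ‖T‖ ≤ 1 / 10 ^ 20) (x₀ y₀ u₀ : H)
    (hx₀ : ‖x₀‖ = 1)
    (hwin : 0.3 + 2.2 * (⟪x₀ - y₀, y₀⟫_ℂ).re ≤ ‖x₀ - y₀‖ ∧ ‖x₀ - y₀‖ ≤ 0.7) (him : (⟪x₀ - y₀, y₀⟫_ℂ).im = 0)
    (ht0 : 0 ≤ (⟪x₀ - y₀, y₀⟫_ℂ).re) (ht1 : (⟪x₀ - y₀, y₀⟫_ℂ).re ≤ 1 / 10 ^ 4)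
    (h9 : ∀ m : ℕ, ‖⟪x₀ - y₀, (T ^ m) y₀⟫_ℂ‖ ≤ (⟪x₀ - y₀, y₀⟫_ℂ).re)
    (hu₀ : ‖u₀‖ ≤ 1) (hA : ‖y₀‖ / 100 ≤ (⟪u₀, y₀⟫_ℂ).re)
    {C β : ℝ} (hC : 0 ≤ C) (hβ : 0 < β) (hβ1 : β ≤ 1) (G : ℝ → ℝ) (hG0 : ∀ x, 0 ≤ G x)
    (hG : ∀ η : ℝ, 0 < η → ∃ δ : ℝ, 0 < δ ∧ ∀ x, 0 ≤ x → x ≤ δ → G x ≤ η) (hclaim : Claim T x₀ Vy.S C β G) :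
    HasNontrivialClosedInvariantSubspace T := by
  rcases exists_state_of_partA T hT hT20 x₀ y₀ u₀ hx₀ hwin him ht0 ht1 h9 hu₀ hA with hinv | ⟨-, s, -⟩
  · exact hinv
  · exact hasNontrivialClosedInvariantSubspace_of_claim T x₀ hx₀ Vy.S Vy.norm_S_le hC hβ hβ1 G hG0 hG hclaim s

/-- **The Part-B residual, packaged over all normalised operators** (the one statement the kernel cannot supply):
on every separable infinite-dimensional Hilbert space, every operator of norm `10⁻²⁰` admits a unit vector `x₀`,
constants `C ≥ 0`, `β ∈ (0, 1]` and an angle modulus `G ≥ 0` with `G → 0⁺`, for which the Main-Construction step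
claim `MCStep.Claim T x₀ Vy.S C β G` holds.  NOT proved anywhere; `ClaimAudit` bounds its instances from both sides.
[cite: Enflo2023, v2 p.17 l.578–583, (40), (45), (46)] -/
@[claim "Enflo2023" "disputed"]
def PartBResidual : Prop :=
  ∀ (H : Type) [NormedAddCommGroup H] [InnerProductSpace ℂ H] [CompleteSpace H]
    [TopologicalSpace.SeparableSpace H], ¬ FiniteDimensional ℂ H →
    ∀ T : H →L[ℂ] H, ‖T‖ = 1e-20 →
      ∃ (x₀ : H) (C β : ℝ) (G : ℝ → ℝ), ‖x₀‖ = 1 ∧ 0 ≤ C ∧ 0 < β ∧ β ≤ 1 ∧ (∀ x, 0 ≤ G x) ∧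
        (∀ η : ℝ, 0 < η → ∃ δ : ℝ, 0 < δ ∧ ∀ x, 0 ≤ x → x ≤ δ → G x ≤ η) ∧ MCStep.Claim T x₀ Vy.S C β G

omit [CompleteSpace H] in
/-- The zero operator on an infinite-dimensional space has a non-trivial closed invariant subspace (any line).
[folklore] -/
theorem nis_zero (hH : ¬ FiniteDimensional ℂ H) : HasNontrivialClosedInvariantSubspace (0 : H →L[ℂ] H) := by
  have hN : Nontrivial H := by
    by_contra h
    rw [not_nontrivial_iff_subsingleton] at h
    exact hH (Module.Finite.of_surjective (0 : (Fin 0 → ℂ) →ₗ[ℂ] H) fun x => ⟨0, Subsingleton.elim _ _⟩)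
  obtain ⟨v, hv⟩ := exists_ne (0 : H)
  refine hasNontrivialClosedInvariantSubspace_of_eigenvector 0 (μ := 0) hv (by simp) fun htop => hH ?_
  have : FiniteDimensional ℂ (⊤ : Submodule ℂ H) := htop ▸ inferInstance
  exact LinearEquiv.finiteDimensional (Submodule.topEquiv : (⊤ : Submodule ℂ H) ≃ₗ[ℂ] H)

/-- **End to end.**  The cell's typed pipeline: the manuscript's theorem `Referee.ISP_separable` follows in the kernel
from the single unproved statement `PartBResidual` — scale `T ≠ 0` to norm `10⁻²⁰` (`wlog_opNorm`, invariant
subspaces are scale-invariant), start the Main Construction at any state (`MCStep.nis_of_claim`), run the endgame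
(`MCStep.hasNontrivialClosedInvariantSubspace_of_claim`: re-pivoting, (45)–(46), `y_n → z ≠ 0` strongly, (11));
`T = 0` has an eigenline.  This is an IMPLICATION; its hypothesis is open. [cite: Enflo2023, v2 p.5, pp.17–22] -/
theorem isp_of_partBResidual (hR : PartBResidual) : Referee.ISP_separable := by
  intro H _ _ _ _ hH T
  by_cases hT0 : T = 0
  · rw [hT0]; exact nis_zero hH
  · obtain ⟨hnorm, hiff⟩ := wlog_opNorm T hT0
    obtain ⟨x₀, C, β, G, hx₀, hC, hβ, hβ1, hG0, hG, hclaim⟩ := hR H hH _ hnorm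
    exact hiff.1 (MCStep.nis_of_claim _ (by rw [hnorm]; norm_num) x₀ hx₀ hC hβ hβ1 G hG0 hG hclaim)

end EndToEnd

end Literature.Analysis.OperatorTheory.Enflo2023

end
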